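import Summits.BirchSwinnertonDyer.BirchSwinnertonDyer.Theorems.PrintCf2SplitBadTwoAvatarValuesTwo
import Summits.BirchSwinnertonDyer.BirchSwinnertonDyer.Theorems.PrintCf2SplitBadTwoFrameSupplyV10OfQuadraticPart
import HarnessLib

/-!
# Crux `PrintCf2.SplitBadTwoRankOneOfFacts` (stmt-BirchSwinnertonDyer-20368), road α v10.2 — THE QUADRATIC-PART SOCKET SQ IS A THEOREM
# (modulo the Deuring-withGenerators print): `quadraticPart_two_holds`, hence S1-v10 `frameSupply_two_v10_holds`

Cell `bsd-print-cf2`, LEAD seat `bsd-line-cf2-p1` g11 (prover-bsd-line-cf2-p1-g11-0); `--supports stmt-BirchSwinnertonDyer-20368` (helper,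
Theses-free). HONEST FRAMING: nothing here closes the crux or a research stub; BSD is not proved by any of this; no summit statement is
proved by this seat. No definition, no named fact, no `sorry`. CONDITIONAL (as displayed binders) on the tree's named facts
`Deuring_exists_heckeCharacter_of_maximalCM_withGenerators` (Silverman ATAEC II Thm. 9.2, 10.5, Cor. 10.4.1(a); statement-only in the tree) and
GZK (`rank_eq_analyticRank_of_analyticRank_le_one`, a conjunct of the crux's own bundle `𝔅_split`).

ASSEMBLY of width seat -w4 g7's B11 series (p654108 pair span, `QuadraticPart*` p65xxxx: sign character, framed θ, Hecke θK by
`exists_heckeChar_of_pow_eq_one`, `θK * θK = 1`, Weil avatar + rigidity `AvatarRigidity.*`, ℤ₂ˣ-valuedness `AvatarPadicUnits.*`,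
ℚ₂-rationality of Deuring's values `AvatarValuesTwo.eventually_mem_range_of_frame`, the triple `exists_v10_triple`) with this seat's
pieces (p637259 §1 `RubinValueTwo.isAlgebraic_inv_galConj_of_isHeckeConjEquivariant` — the «λ algebraic» hypothesis -w4 g7 left displayed IS
a tree theorem; p655731 `frameSupply_two_v10_of_quadraticPart`; the value bound from `exists_v10_triple`'s entry clause `4 ∣ χθ̂ − 1`):
* **`quadraticPart_two_holds`** — the socket SQ of the v10.2 skeleton (`Lines/rubin_value_two_lead_v10_2.lean`) VERBATIM: for Deuring's ψ of a
  member and ANY generator pair at 2, ∃ θ θK ρ r Sθ with θ² = 1, `IsHeckeCharOf ι θ θK`, θK² = 1, `IsPAdicAvatarOf ι ρ r`,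
  `FactorsThroughPair κ₁ κ₂ r`, θK⁻¹ρ = (ψ∘c)⁻¹, exact tame set, and **‖r(γᵢ⁻¹) − 1‖ < 1** (indeed `< 1` for every σ: the entry of `r σ` is
  `χ(σ)θ̂(σ) ≡ 1 (mod 4)` in `ℤ₂`);
* **`frameSupply_two_v10_holds`** — S1-v10's conclusion for every member, from GZK and Deuring-withGenerators alone.
presearch: not applicable (assembly; no stub statement changed, no fact filed).

References: [deShalit1987] II.4.17 (54); [SilvermanATAEC1994] Ch. II Thm. 9.2, 10.5, Cor. 10.4.1; [CastellaGrossiLeeSkinner2022] Thm. 2.1.2;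
[SerreAbelianLadic1968] Ch. II §2.7.
-/

set_option autoImplicit false
set_option linter.dupNamespace false

noncomputable section

open scoped Classical
open NumberField IsDedekindDomain Field WeierstrassCurve Filter
open Literature.NumberTheory.GaloisRepresentations Literature.NumberTheory.EllipticCurves
open Literature.NumberTheory.EllipticCurves.Rank1Residual
open Literature.NumberTheory.EllipticCurves.DeShalit1987
open Literature.NumberTheory.EllipticCurves.KellerYin2024

namespace Summit.BirchSwinnertonDyer.BirchSwinnertonDyer.Theorems.PrintCf2.RubinValueTwoV10

open Summit.BirchSwinnertonDyer.BirchSwinnertonDyer.Theorems.PrintCf2.QuadraticPart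

/-- **The value bound**: if the entry of the rank-one framed `r σ` is `j(u)` for `u ∈ ℤ₂` with `4 ∣ u − 1` (`j : ℤ₂ → ℚ₂ → ℚ̄₂`), then
`‖r̂(σ) − 1‖ < 1` in `ℂ₂` (`‖u − 1‖ ≤ 2⁻²`; the embeddings are isometric). [cite: deShalit1987, II.4.17 (54)] -/
theorem norm_avatarValueAt_sub_one_lt_one {K : Type} [Field K] {r : FramedGaloisRep K (PadicAlgCl 2) 1}
    {σ : absoluteGaloisGroup K} {u : ℤ_[2]}
    (hr : (((r σ : GL (Fin 1) (PadicAlgCl 2)) : Matrix (Fin 1) (Fin 1) (PadicAlgCl 2)) 0 0) =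
      ((algebraMap ℚ_[2] (PadicAlgCl 2)).comp PadicInt.Coe.ringHom) u)
    (h4 : (4 : ℤ_[2]) ∣ u - 1) : ‖avatarValueAt r σ - 1‖ < 1 := by
  have hdet : ((Matrix.GeneralLinearGroup.det (r σ) : (PadicAlgCl 2)ˣ) : PadicAlgCl 2) =
      ((algebraMap ℚ_[2] (PadicAlgCl 2)).comp PadicInt.Coe.ringHom) u := by
    rw [Matrix.GeneralLinearGroup.val_det_apply, Matrix.det_fin_one, hr]
  have hval : avatarValueAt r σ - 1 =
      ((((algebraMap ℚ_[2] (PadicAlgCl 2)).comp PadicInt.Coe.ringHom) (u - 1) : PadicAlgCl 2) : ℂ_[2]) := by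
    rw [avatarValueAt, hdet, map_sub, map_one, UniformSpace.Completion.coe_sub, UniformSpace.Completion.coe_one]
  rw [hval, UniformSpace.Completion.norm_coe, RingHom.comp_apply, norm_algebraMap', PadicInt.Coe.ringHom_apply,
    PadicInt.padic_norm_e_of_padicInt, PadicInt.norm_lt_one_iff_dvd]
  exact dvd_trans ⟨2, by norm_num⟩ h4

variable {K : Type} [Field K] [NumberField K]

/-- **SQ — THE QUADRATIC-PART SOCKET IS A THEOREM** (modulo the Deuring-withGenerators print): the statement of the v10.2 stub
`stub_quadraticPart_two` VERBATIM. [cite: deShalit1987, II.4.17 (54)] [cite: SilvermanATAEC1994, Ch. II Thm. 9.2 and Cor. 10.4.1 (a)]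
[cite: CastellaGrossiLeeSkinner2022, Thm. 2.1.2 (θ_K)] -/
theorem quadraticPart_two_holds :
    Deuring_exists_heckeCharacter_of_maximalCM_withGenerators →
    ∀ (d : ℤ), d ≠ 0 → ∀ (W : WeierstrassCurve ℚ) [W.IsElliptic] [W.IsGloballyMinimal] (C : VariableChange ℚ),
      C • W = cm7.quadraticTwist (d : ℚ) →
      ∀ (K : Type) [Field K] [NumberField K], IsImaginaryQuadratic K →
      ∀ (v vbar : HeightOneSpectrum (𝓞 K)),
        ((2 : ℕ) : 𝓞 K) ∈ v.asIdeal → ((2 : ℕ) : 𝓞 K) ∈ vbar.asIdeal → vbar ≠ v →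
      ∀ (ι : PadicAlgCl 2 ≃+* ℂ),
        (∀ (w : InfinitePlace K) (k : 𝓞 K), k ∈ v.asIdeal ↔ ‖ι.symm (w.embedding (k : K))‖ < 1) →
      ∀ (c : K ≃ₐ[ℚ] K), c ≠ 1 →
      ∀ (ψ : HeckeCharacter K), ψ.HasInfinityType (fun _ ↦ 1) (fun _ ↦ 0) → IsHeckeConjEquivariant c ψ →
        (∀ s : ℂ, 3 / 2 < s.re → heckeLFunction ψ s = W.LSeries s) →
      ∀ (κ₁ κ₂ : ZpExtension K 2) (γ₁ γ₂ : absoluteGaloisGroup K), ZpExtension.IsTopGeneratorPair κ₁ κ₂ γ₁ γ₂ →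
      ∃ (θ : FramedGaloisRep K (padicCoeffIntegers (∅ : Set (PadicAlgCl 2))) 1)
        (θK ρ : HeckeCharacter K) (r : FramedGaloisRep K (PadicAlgCl 2) 1) (Sθ : Finset (HeightOneSpectrum (𝓞 K))),
        (∀ σ : absoluteGaloisGroup K, θ σ ^ 2 = 1) ∧ KellerYin2024.IsHeckeCharOf ι θ θK ∧ θK * θK = 1 ∧
        IsPAdicAvatarOf ι ρ r ∧ FactorsThroughPair κ₁ κ₂ r ∧ θK⁻¹ * ρ = (HeckeCharacter.galConj c ψ)⁻¹ ∧
        v ∉ Sθ ∧ vbar ∉ Sθ ∧ (∀ w ∈ Sθ, ¬ θK.IsUnramifiedAt w) ∧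
        (∀ w : HeightOneSpectrum (𝓞 K), w ∉ Sθ → w ≠ v → w ≠ vbar → θK.IsUnramifiedAt w) ∧
        ‖avatarValueAt r γ₁⁻¹ - 1‖ < 1 ∧ ‖avatarValueAt r γ₂⁻¹ - 1‖ < 1 := by
  intro hDe d hd0 W _ _ C hC K _ _ hK v vbar hv hvbar hne ι _hι c hc ψ hψinf hψconj hψL κ₁ κ₂ γ₁ γ₂ hpair
  have hlam : (HeckeCharacter.galConj c ψ)⁻¹.IsAlgebraic :=
    RubinValueTwo.isAlgebraic_inv_galConj_of_isHeckeConjEquivariant hψconj hψinf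
  obtain ⟨r₀, hr₀⟩ := AvatarRigidity.exists_isPAdicAvatarOf ι hlam
  obtain ⟨χ, hχ⟩ := AvatarRigidity.exists_padicIntUnitsChar_of_isPAdicAvatarOf ι hr₀
    (eventually_mem_range_of_frame hDe hd0 hC hK hv hvbar hne ι c hc hψinf hψL)
  obtain ⟨θs, θ, θK, ρ, r, -, hθsχ, hθ2, -, -, hH, -, hsq, -, hρ', hav, hentry, hfac⟩ :=
    exists_v10_triple (∅ : Set (PadicAlgCl 2)) ι hK hlam χ (fun σ ↦ by rw [hχ σ]; rfl) hr₀
  obtain ⟨Sθ, hvS, hvbarS, hSram, hSunr⟩ := exists_exactTameSet θK v vbar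
  have hbound : ∀ σ : absoluteGaloisGroup K, ‖avatarValueAt r σ - 1‖ < 1 := fun σ ↦
    norm_avatarValueAt_sub_one_lt_one (u := ((χ σ : ℤ_[2]ˣ) * (θs σ : ℤ_[2]ˣ) : ℤ_[2]ˣ)) (hentry σ)
      (by rw [Units.val_mul]; exact hθsχ σ)
  exact ⟨θ, θK, ρ, r, Sθ, hθ2, hH, hsq, hav, hfac hpair, hρ', hvS, hvbarS, hSram, hSunr, hbound _, hbound _⟩

/-- **S1-v10 HOLDS** (the supply of the two-variable-native frame for every member), from GZK and the Deuring-withGenerators print: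
`frameSupply_two_v10_of_quadraticPart quadraticPart_two_holds`. [cite: deShalit1987, II.4.17 (54)] [cite: SilvermanATAEC1994, Ch. II Thm. 9.2] -/
theorem frameSupply_two_v10_holds (hGZK : rank_eq_analyticRank_of_analyticRank_le_one)
    (hDe : Deuring_exists_heckeCharacter_of_maximalCM_withGenerators) :
    ∀ (d : ℤ), d ≠ 0 → Squarefree d → d % 4 ≠ 1 →
    ∀ (W : WeierstrassCurve ℚ) [W.IsElliptic] [W.IsGloballyMinimal] (C : VariableChange ℚ),
      C • W = cm7.quadraticTwist (d : ℚ) → W.analyticRank = 1 →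
    ∃ (K : Type) (_ : Field K) (_ : NumberField K) (v vbar : HeightOneSpectrum (𝓞 K))
      (ι : PadicAlgCl 2 ≃+* ℂ) (c : K ≃ₐ[ℚ] K) (ψ : HeckeCharacter K)
      (κ₁ κ₂ : ZpExtension K 2) (γ₁ γ₂ : absoluteGaloisGroup K)
      (θ : FramedGaloisRep K (padicCoeffIntegers (∅ : Set (PadicAlgCl 2))) 1)
      (θK ρ : HeckeCharacter K) (r : FramedGaloisRep K (PadicAlgCl 2) 1)
      (Sθ : Finset (HeightOneSpectrum (𝓞 K)))
      (P : W.toAffine.Point) (c₀ : ℕ) (ℓ : ℤ),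
      IsImaginaryQuadratic K ∧ ¬ 2 ∣ NumberField.classNumber K ∧
      ((2 : ℕ) : 𝓞 K) ∈ v.asIdeal ∧ ((2 : ℕ) : 𝓞 K) ∈ vbar.asIdeal ∧ vbar ≠ v ∧
      (∀ (w : InfinitePlace K) (k : 𝓞 K), k ∈ v.asIdeal ↔ ‖ι.symm (w.embedding (k : K))‖ < 1) ∧
      c ≠ 1 ∧
      ψ.HasInfinityType (fun _ ↦ 1) (fun _ ↦ 0) ∧
      (∀ s : ℂ, 3 / 2 < s.re → heckeLFunction ψ s = W.LSeries s) ∧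
      ZpExtension.IsTopGeneratorPair κ₁ κ₂ γ₁ γ₂ ∧
      (∀ σ : absoluteGaloisGroup K, θ σ ^ 2 = 1) ∧ KellerYin2024.IsHeckeCharOf ι θ θK ∧ θK * θK = 1 ∧
      IsPAdicAvatarOf ι ρ r ∧ FactorsThroughPair κ₁ κ₂ r ∧ θK⁻¹ * ρ = (HeckeCharacter.galConj c ψ)⁻¹ ∧
      v ∉ Sθ ∧ vbar ∉ Sθ ∧ (∀ w ∈ Sθ, ¬ θK.IsUnramifiedAt w) ∧
      (∀ w : HeightOneSpectrum (𝓞 K), w ∉ Sθ → w ≠ v → w ≠ vbar → θK.IsUnramifiedAt w) ∧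
      (∀ G₂ : PowerSeries (PowerSeries (PadicComplexInt 2)), ∃ val : ℂ_[2],
        IntSeries.HasValueAt₂ G₂ (avatarValueAt r γ₁⁻¹ - 1) (avatarValueAt r γ₂⁻¹ - 1) val) ∧
      ¬ IsOfFinAddOrder P ∧
      (∀ R : W.toAffine.Point, ∃ (k : ℤ) (T : W.toAffine.Point), IsOfFinAddOrder T ∧ R = k • P + T) ∧
      c₀ ≠ 0 ∧ (W.baseChange ℚ_[2]).IsInReductionKernel (c₀ • W.toPadicPoint 2 P) ∧
      ‖(W.baseChange ℚ_[2]).padicLogPoint (c₀ • W.toPadicPoint 2 P) / (c₀ : ℚ_[2])‖ = (2 : ℝ) ^ (-ℓ) :=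
  frameSupply_two_v10_of_quadraticPart (quadraticPart_two_holds hDe) hGZK
    (Deuring_exists_heckeCharacter_of_maximalCM_of_withGenerators hDe)

end Summit.BirchSwinnertonDyer.BirchSwinnertonDyer.Theorems.PrintCf2.RubinValueTwoV10

end
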